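import Summits.Ventures.Crystal3D.Theorems.StickyWulffConstantNoReconstructionGainSymmetry
import Summits.Ventures.Crystal3D.Theorems.StickyWulffConstantNoReconstructionGainGrainAdhesion
import Summits.Ventures.Crystal3D.Theorems.StickyWulffConstantNoReconstructionGainLowCoordAdhesion
import Summits.Ventures.Crystal3D.Theorems.StickyWulffConstantNoReconstructionGainCubeLocalRuleAdhesion
import HarnessLib

/-!
# Lattice-symmetry transport, II: rungs with side conditions, on whole `O_h`-orbits

HONEST FRAMING. Part of the venture `Summits/Ventures/Crystal3D` (cell `crystal3d-full`), helper
`--supports` the crux `NoReconstructionGain` (stmt-Ventures-19144, route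
`route-Ventures-StickyWulffConstant`), line `adhesion`; companion of `…NoReconstructionGainSymmetry`.
There the plain atom (Finset form of the registered stub `stub_adhesion` at a fixed normal) was
transported along every linear isometry `g` of `ℝ³` with `g Λ₀ = Λ₀`.  The line's landed rungs carry
SIDE CONDITIONS on the film `X ∖ P` (coordination `≤ 9` at `(111)`, `≤ 8` at `(100)`, «contained in one
rigid-motion image of a Barlow stacking»); here the transport is stated with an arbitrary side
condition `Φ X P` that is inherited by the pulled-back configuration
(`adhesion_transport_of_invariant`), the three side conditions are shown to be inherited
(`coordBound_image_of_isometry`, `grainHypothesis_image`), and the rungs are re-issued ON THE WHOLE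
ORBIT of their normal, with constants uniform over the orbit:

* `barlowGrainAdhesion_transport` — g4's grain rung (`R = 4`, `C = 1020π`) at every `g e₃`;
* `lowCoordAdhesion_nine_transport` — g3's coordination-`≤ 9` rung (`R = 4`, `C = 450π`) at every
  `g e₃`;
* `cubeLowCoordAdhesion_eight_transport` — g3's cube-facet coordination-`≤ 8` rung (`R = 4`,
  `C = 432π`) at every `g ν₁₀₀`, `ν₁₀₀ = (√2/2, √6/6, −√3/3)`;

`g` ranging over the linear isometries with `g Λ₀ ⊆ Λ₀ ⊇ g⁻¹ Λ₀` (all 48 elements of `O_h`, generated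
by the bond mirrors and `−1` of `…Symmetry`): the orbit of `e₃` is the set of the eight hexagonal
normals, that of `ν₁₀₀` the six cube normals.

WHAT THIS IS NOT: no new film class — the same three rungs, now at 8 / 8 / 6 normals instead of one;
the atom for dense off-lattice films of coordination `≥ 10` is open at every normal; rung F-C1 not
moved.
-/

noncomputable section

namespace Summit.Ventures.Crystal3D.Theorems

open Summit.Ventures.Crystal3D Finset
open Literature.MathematicalPhysics.StatisticalMechanics (barlowPos barlowStacking fccStacking
  IsHaggSeq constHagg orderedContacts contactDeficiency)
open scoped InnerProductSpace

/-! ### 1. Transport with an inherited side condition -/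

/-- **Transport of the atom with a side condition.**  `Φ X P` is any property of the configuration
inherited by its image under `g⁻¹`; if the atom at `ν` (fixed `R, C, ρ`) holds for all `(X, P)` with
`Φ`, then the atom at `g ν` holds for all `(X, P)` with `Φ`. -/
theorem adhesion_transport_of_invariant :
    ∀ (Φ : Finset (EuclideanSpace ℝ (Fin 3)) → Finset (EuclideanSpace ℝ (Fin 3)) → Prop)
    (g : EuclideanSpace ℝ (Fin 3) ≃ₗᵢ[ℝ] EuclideanSpace ℝ (Fin 3)),
    (∀ p ∈ Literature.MathematicalPhysics.StatisticalMechanics.fccStacking 1 (Real.sqrt (2 / 3)),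
      g p ∈ Literature.MathematicalPhysics.StatisticalMechanics.fccStacking 1 (Real.sqrt (2 / 3))) →
    (∀ p ∈ Literature.MathematicalPhysics.StatisticalMechanics.fccStacking 1 (Real.sqrt (2 / 3)),
      g.symm p ∈ Literature.MathematicalPhysics.StatisticalMechanics.fccStacking 1 (Real.sqrt (2 / 3))) →
    (∀ X P : Finset (EuclideanSpace ℝ (Fin 3)), Φ X P → Φ (X.image g.symm) (P.image g.symm)) →
    ∀ (ν : EuclideanSpace ℝ (Fin 3)) (R C ρ : ℝ),
    (∀ X P : Finset (EuclideanSpace ℝ (Fin 3)), (∀ p ∈ X, ∀ q ∈ X, p ≠ q → 1 ≤ dist p q) →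
      P ⊆ X →
      (∀ p, p ∈ P ↔ (p ∈ Literature.MathematicalPhysics.StatisticalMechanics.fccStacking 1
        (Real.sqrt (2 / 3)) ∧ -(2 * R) ≤ ⟪p, ν⟫_ℝ ∧ ⟪p, ν⟫_ℝ ≤ -R ∧ ‖p‖ ^ 2 - ⟪p, ν⟫_ℝ ^ 2 ≤ ρ ^ 2)) →
      Φ X P →
      ((((P ×ˢ (X \ P)).filter fun pq => dist pq.1 pq.2 = 1).card : ℕ) : ℝ) ≤
        Literature.MathematicalPhysics.StatisticalMechanics.contactDeficiency (X \ P) + C * ρ) →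
    ∀ X P : Finset (EuclideanSpace ℝ (Fin 3)), (∀ p ∈ X, ∀ q ∈ X, p ≠ q → 1 ≤ dist p q) →
      P ⊆ X →
      (∀ p, p ∈ P ↔ (p ∈ Literature.MathematicalPhysics.StatisticalMechanics.fccStacking 1
        (Real.sqrt (2 / 3)) ∧ -(2 * R) ≤ ⟪p, g ν⟫_ℝ ∧ ⟪p, g ν⟫_ℝ ≤ -R ∧
        ‖p‖ ^ 2 - ⟪p, g ν⟫_ℝ ^ 2 ≤ ρ ^ 2)) →
      Φ X P →
      ((((P ×ˢ (X \ P)).filter fun pq => dist pq.1 pq.2 = 1).card : ℕ) : ℝ) ≤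
        Literature.MathematicalPhysics.StatisticalMechanics.contactDeficiency (X \ P) + C * ρ := by
  classical
  intro Φ g hg hg' hΦ ν R C ρ h X P hX hPX hP hΦXP
  have hgi : Isometry (g.symm : EuclideanSpace ℝ (Fin 3) → EuclideanSpace ℝ (Fin 3)) :=
    g.symm.isometry
  have hinj : Function.Injective (g.symm : EuclideanSpace ℝ (Fin 3) → EuclideanSpace ℝ (Fin 3)) :=
    g.symm.injective
  set X' := X.image g.symm with hX'
  set P' := P.image g.symm with hP'def
  have hsd : X' \ P' = (X \ P).image g.symm := by
    rw [hX', hP'def, image_sdiff_of_injOn hinj.injOn hPX]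
  have hXp : ∀ p ∈ X', ∀ q ∈ X', p ≠ q → 1 ≤ dist p q := by
    intro p hp q hq hpq
    obtain ⟨p₀, hp₀, rfl⟩ := mem_image.1 hp
    obtain ⟨q₀, hq₀, rfl⟩ := mem_image.1 hq
    rw [hgi.dist_eq]
    exact hX p₀ hp₀ q₀ hq₀ fun e => hpq (by rw [e])
  have hPXp : P' ⊆ X' := image_subset_image hPX
  have hinn : ∀ p, ⟪g.symm p, ν⟫_ℝ = ⟪p, g ν⟫_ℝ := fun p => by
    rw [← g.inner_map_map (g.symm p) ν, LinearIsometryEquiv.apply_symm_apply]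
  have hPp : ∀ p, p ∈ P' ↔ (p ∈ fccStacking 1 (Real.sqrt (2 / 3)) ∧ -(2 * R) ≤ ⟪p, ν⟫_ℝ ∧
      ⟪p, ν⟫_ℝ ≤ -R ∧ ‖p‖ ^ 2 - ⟪p, ν⟫_ℝ ^ 2 ≤ ρ ^ 2) := by
    intro p
    rw [hP'def, mem_image]
    constructor
    · rintro ⟨p₀, hp₀, rfl⟩
      obtain ⟨hΛ, h1, h2, h3⟩ := (hP p₀).1 hp₀
      refine ⟨hg' p₀ hΛ, ?_, ?_, ?_⟩
      · rw [hinn]; exact h1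
      · rw [hinn]; exact h2
      · rw [hinn, LinearIsometryEquiv.norm_map]; exact h3
    · rintro ⟨hΛ, h1, h2, h3⟩
      have hi : ⟪g p, g ν⟫_ℝ = ⟪p, ν⟫_ℝ := g.inner_map_map p ν
      refine ⟨g p, (hP (g p)).2 ⟨hg p hΛ, ?_, ?_, ?_⟩, g.symm_apply_apply p⟩
      · rw [hi]; exact h1
      · rw [hi]; exact h2
      · rw [hi, LinearIsometryEquiv.norm_map]; exact h3
  have hmain := h X' P' hXp hPXp hPp (hΦ X P hΦXP)
  rw [hsd, hP'def, card_cross_image_of_isometry hgi, contactDeficiency_image_of_isometry hgi]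
    at hmain
  exact hmain

/-! ### 2. The side conditions of the landed rungs are inherited -/

/-- A coordination bound on the film `X ∖ P` is inherited by the image under an isometry. -/
theorem coordBound_image_of_isometry {g : EuclideanSpace ℝ (Fin 3) → EuclideanSpace ℝ (Fin 3)}
    (hg : Isometry g) (k : ℕ) (X P : Finset (EuclideanSpace ℝ (Fin 3)))
    (h : ∀ q ∈ X \ P, (X.filter fun x => dist q x = 1).card ≤ k) :
    ∀ q ∈ X.image g \ P.image g, ((X.image g).filter fun x => dist q x = 1).card ≤ k := by
  classical
  intro q hq
  obtain ⟨hqX, hqP⟩ := mem_sdiff.1 hq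
  obtain ⟨q₀, hq₀, rfl⟩ := mem_image.1 hqX
  have hq₀P : q₀ ∉ P := fun h0 => hqP (mem_image_of_mem g h0)
  have hset : ((X.image g).filter fun x => dist (g q₀) x = 1) =
      (X.filter fun x => dist q₀ x = 1).image g := by
    rw [filter_image]
    congr 1
    refine filter_congr fun x _ => ?_
    rw [hg.dist_eq]
  rw [hset, card_image_of_injective _ hg.injective]
  exact h q₀ (mem_sdiff.2 ⟨hq₀, hq₀P⟩)

/-- «The film is contained in one rigid-motion image of a Barlow stacking» is inherited by the image
under a linear isometry (compose the rigid motion). -/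
theorem grainHypothesis_image (g : EuclideanSpace ℝ (Fin 3) ≃ₗᵢ[ℝ] EuclideanSpace ℝ (Fin 3))
    (X P : Finset (EuclideanSpace ℝ (Fin 3))) (hPX : P ⊆ X)
    (h : ∃ (A : EuclideanSpace ℝ (Fin 3) ≃ₗᵢ[ℝ] EuclideanSpace ℝ (Fin 3))
        (t : EuclideanSpace ℝ (Fin 3)) (σ : ℤ → ℤ), IsHaggSeq σ ∧
        (↑(X \ P) : Set (EuclideanSpace ℝ (Fin 3))) ⊆
          (fun p => A p + t) '' barlowStacking 1 (Real.sqrt (2 / 3)) σ) :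
    ∃ (A : EuclideanSpace ℝ (Fin 3) ≃ₗᵢ[ℝ] EuclideanSpace ℝ (Fin 3))
        (t : EuclideanSpace ℝ (Fin 3)) (σ : ℤ → ℤ), IsHaggSeq σ ∧
        (↑(X.image g \ P.image g) : Set (EuclideanSpace ℝ (Fin 3))) ⊆
          (fun p => A p + t) '' barlowStacking 1 (Real.sqrt (2 / 3)) σ := by
  classical
  obtain ⟨A, t, σ, hσ, hsub⟩ := h
  refine ⟨A.trans g, g t, σ, hσ, ?_⟩
  rw [← image_sdiff_of_injOn g.injective.injOn hPX, coe_image]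
  rintro _ ⟨x, hx, rfl⟩
  obtain ⟨r, hr, hrx⟩ := hsub hx
  refine ⟨r, hr, ?_⟩
  simp only at hrx ⊢
  rw [← hrx, LinearIsometryEquiv.trans_apply, map_add]

/-! ### 3. The rungs on the whole orbit of their normal -/

/-- **The grain rung at every hexagonal normal.**  With `R = 4`, `C = 1020π` uniformly: for every
linear isometry `g` of `ℝ³` mapping `Λ₀` onto itself, every `ρ ≥ R`, every finite unit packing
`X ⊇ P` with `P` the `g e₃`-slab sample whose film `X ∖ P` lies in ONE rigid-motion image of SOME
Barlow stacking: `#cross(P, X∖P) ≤ contactDeficiency (X∖P) + C ρ`.  (`g e₃` runs over the eight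
`(111)`-type normals of `Λ₀`; transport of `barlowGrainAdhesion111`.) -/
theorem barlowGrainAdhesion_transport :
    ∃ R C : ℝ, 1 ≤ R ∧ ∀ g : EuclideanSpace ℝ (Fin 3) ≃ₗᵢ[ℝ] EuclideanSpace ℝ (Fin 3),
    (∀ p ∈ Literature.MathematicalPhysics.StatisticalMechanics.fccStacking 1 (Real.sqrt (2 / 3)),
      g p ∈ Literature.MathematicalPhysics.StatisticalMechanics.fccStacking 1 (Real.sqrt (2 / 3))) →
    (∀ p ∈ Literature.MathematicalPhysics.StatisticalMechanics.fccStacking 1 (Real.sqrt (2 / 3)),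
      g.symm p ∈ Literature.MathematicalPhysics.StatisticalMechanics.fccStacking 1 (Real.sqrt (2 / 3))) →
    ∀ ρ : ℝ, R ≤ ρ → ∀ X P : Finset (EuclideanSpace ℝ (Fin 3)),
      (∀ p ∈ X, ∀ q ∈ X, p ≠ q → 1 ≤ dist p q) → P ⊆ X →
      (∀ p, p ∈ P ↔ (p ∈ Literature.MathematicalPhysics.StatisticalMechanics.fccStacking 1
          (Real.sqrt (2 / 3)) ∧
        -(2 * R) ≤ ⟪p, g (EuclideanSpace.single (2 : Fin 3) (1 : ℝ))⟫_ℝ ∧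
        ⟪p, g (EuclideanSpace.single (2 : Fin 3) (1 : ℝ))⟫_ℝ ≤ -R ∧
        ‖p‖ ^ 2 - ⟪p, g (EuclideanSpace.single (2 : Fin 3) (1 : ℝ))⟫_ℝ ^ 2 ≤ ρ ^ 2)) →
      (∃ (A : EuclideanSpace ℝ (Fin 3) ≃ₗᵢ[ℝ] EuclideanSpace ℝ (Fin 3))
          (t : EuclideanSpace ℝ (Fin 3)) (σ : ℤ → ℤ),
          Literature.MathematicalPhysics.StatisticalMechanics.IsHaggSeq σ ∧
          (↑(X \ P) : Set (EuclideanSpace ℝ (Fin 3))) ⊆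
            (fun p => A p + t) ''
              Literature.MathematicalPhysics.StatisticalMechanics.barlowStacking 1 (Real.sqrt (2 / 3)) σ) →
      ((((P ×ˢ (X \ P)).filter fun pq => dist pq.1 pq.2 = 1).card : ℕ) : ℝ) ≤
        Literature.MathematicalPhysics.StatisticalMechanics.contactDeficiency (X \ P) + C * ρ := by
  classical
  obtain ⟨R, C, hR, h⟩ := barlowGrainAdhesion111
  refine ⟨R, C, hR, fun g hg hg' ρ hρ X P hX hPX hP hgrain => ?_⟩
  refine adhesion_transport_of_invariant
    (fun X P => P ⊆ X ∧ ∃ (A : EuclideanSpace ℝ (Fin 3) ≃ₗᵢ[ℝ] EuclideanSpace ℝ (Fin 3))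
        (t : EuclideanSpace ℝ (Fin 3)) (σ : ℤ → ℤ), IsHaggSeq σ ∧
        (↑(X \ P) : Set (EuclideanSpace ℝ (Fin 3))) ⊆
          (fun p => A p + t) '' barlowStacking 1 (Real.sqrt (2 / 3)) σ)
    g hg hg' ?_ _ R C ρ ?_ X P hX hPX hP ⟨hPX, hgrain⟩
  · rintro X' P' ⟨hPX', hgr'⟩
    exact ⟨image_subset_image hPX', grainHypothesis_image g.symm X' P' hPX' hgr'⟩
  · intro X' P' hX' hPX' hP' hΦ
    exact h ρ hρ X' P' hX' hPX' hP' hΦ.2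

/-- **The coordination-`≤ 9` rung at every hexagonal normal.**  With `R = 4`, `C = 450π` uniformly:
for every lattice isometry `g`, the atom at `g e₃` for every film all of whose balls have at most
nine contacts (transport of `lowCoordAdhesion111_nine`). -/
theorem lowCoordAdhesion_nine_transport :
    ∃ R C : ℝ, 1 ≤ R ∧ ∀ g : EuclideanSpace ℝ (Fin 3) ≃ₗᵢ[ℝ] EuclideanSpace ℝ (Fin 3),
    (∀ p ∈ Literature.MathematicalPhysics.StatisticalMechanics.fccStacking 1 (Real.sqrt (2 / 3)),
      g p ∈ Literature.MathematicalPhysics.StatisticalMechanics.fccStacking 1 (Real.sqrt (2 / 3))) →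
    (∀ p ∈ Literature.MathematicalPhysics.StatisticalMechanics.fccStacking 1 (Real.sqrt (2 / 3)),
      g.symm p ∈ Literature.MathematicalPhysics.StatisticalMechanics.fccStacking 1 (Real.sqrt (2 / 3))) →
    ∀ ρ : ℝ, R ≤ ρ → ∀ X P : Finset (EuclideanSpace ℝ (Fin 3)),
      (∀ p ∈ X, ∀ q ∈ X, p ≠ q → 1 ≤ dist p q) → P ⊆ X →
      (∀ p, p ∈ P ↔ (p ∈ Literature.MathematicalPhysics.StatisticalMechanics.fccStacking 1
          (Real.sqrt (2 / 3)) ∧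
        -(2 * R) ≤ ⟪p, g (EuclideanSpace.single (2 : Fin 3) (1 : ℝ))⟫_ℝ ∧
        ⟪p, g (EuclideanSpace.single (2 : Fin 3) (1 : ℝ))⟫_ℝ ≤ -R ∧
        ‖p‖ ^ 2 - ⟪p, g (EuclideanSpace.single (2 : Fin 3) (1 : ℝ))⟫_ℝ ^ 2 ≤ ρ ^ 2)) →
      (∀ q ∈ X \ P, (X.filter fun x => dist q x = 1).card ≤ 9) →
      ((((P ×ˢ (X \ P)).filter fun pq => dist pq.1 pq.2 = 1).card : ℕ) : ℝ) ≤
        Literature.MathematicalPhysics.StatisticalMechanics.contactDeficiency (X \ P) + C * ρ := by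
  classical
  obtain ⟨R, C, hR, h⟩ := lowCoordAdhesion111_nine
  refine ⟨R, C, hR, fun g hg hg' ρ hρ X P hX hPX hP hdeg => ?_⟩
  refine adhesion_transport_of_invariant
    (fun X P => ∀ q ∈ X \ P, (X.filter fun x => dist q x = 1).card ≤ 9)
    g hg hg' (fun X' P' h' => coordBound_image_of_isometry g.symm.isometry 9 X' P' h') _ R C ρ
    (fun X' P' hX' hPX' hP' hΦ => h ρ hρ X' P' hX' hPX' hP' hΦ) X P hX hPX hP hdeg

/-- **The cube-facet coordination-`≤ 8` rung at every cube normal.**  With `R = 4`, `C = 432π`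
uniformly: for every lattice isometry `g`, the atom at `g ν₁₀₀` (`ν₁₀₀ = (√2/2, √6/6, −√3/3)`, a
`(100)` normal of `Λ₀`; the orbit is the six cube normals) for every film all of whose balls have at
most eight contacts (transport of `cubeLowCoordAdhesion100_eight`). -/
theorem cubeLowCoordAdhesion_eight_transport :
    ∃ R C : ℝ, 1 ≤ R ∧ ∀ g : EuclideanSpace ℝ (Fin 3) ≃ₗᵢ[ℝ] EuclideanSpace ℝ (Fin 3),
    (∀ p ∈ Literature.MathematicalPhysics.StatisticalMechanics.fccStacking 1 (Real.sqrt (2 / 3)),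
      g p ∈ Literature.MathematicalPhysics.StatisticalMechanics.fccStacking 1 (Real.sqrt (2 / 3))) →
    (∀ p ∈ Literature.MathematicalPhysics.StatisticalMechanics.fccStacking 1 (Real.sqrt (2 / 3)),
      g.symm p ∈ Literature.MathematicalPhysics.StatisticalMechanics.fccStacking 1 (Real.sqrt (2 / 3))) →
    ∀ ρ : ℝ, R ≤ ρ → ∀ X P : Finset (EuclideanSpace ℝ (Fin 3)),
      (∀ p ∈ X, ∀ q ∈ X, p ≠ q → 1 ≤ dist p q) → P ⊆ X →
      (∀ p, p ∈ P ↔ (p ∈ Literature.MathematicalPhysics.StatisticalMechanics.fccStacking 1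
          (Real.sqrt (2 / 3)) ∧
        -(2 * R) ≤ ⟪p, g (!₂[Real.sqrt 2 / 2, Real.sqrt 6 / 6, -(Real.sqrt 3 / 3)])⟫_ℝ ∧
        ⟪p, g (!₂[Real.sqrt 2 / 2, Real.sqrt 6 / 6, -(Real.sqrt 3 / 3)])⟫_ℝ ≤ -R ∧
        ‖p‖ ^ 2 - ⟪p, g (!₂[Real.sqrt 2 / 2, Real.sqrt 6 / 6, -(Real.sqrt 3 / 3)])⟫_ℝ ^ 2 ≤ ρ ^ 2)) →
      (∀ q ∈ X \ P, (X.filter fun x => dist q x = 1).card ≤ 8) →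
      ((((P ×ˢ (X \ P)).filter fun pq => dist pq.1 pq.2 = 1).card : ℕ) : ℝ) ≤
        Literature.MathematicalPhysics.StatisticalMechanics.contactDeficiency (X \ P) + C * ρ := by
  classical
  obtain ⟨R, C, hR, h⟩ := cubeLowCoordAdhesion100_eight
  refine ⟨R, C, hR, fun g hg hg' ρ hρ X P hX hPX hP hdeg => ?_⟩
  refine adhesion_transport_of_invariant
    (fun X P => ∀ q ∈ X \ P, (X.filter fun x => dist q x = 1).card ≤ 8)
    g hg hg' (fun X' P' h' => coordBound_image_of_isometry g.symm.isometry 8 X' P' h') _ R C ρ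
    (fun X' P' hX' hPX' hP' hΦ => h ρ hρ X' P' hX' hPX' hP' hΦ) X P hX hPX hP hdeg

end Summit.Ventures.Crystal3D.Theorems
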